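import Summits.RiemannHypothesis.RiemannHypothesis.Theses.OddSector
import Literature.NumberTheory.LFunctions.WeilOddGroundState
import Literature.NumberTheory.LFunctions.WeilGroundEnergyParitySplit
import Literature.NumberTheory.LFunctions.WeilResolventVectorExists
import Literature.NumberTheory.LFunctions.WeilGroundStateRealZerosProofs
import HarnessLib

/-!
# Real odd-sector ground states (helper for `OddSector.OddOneSignedWindows`)

Route `OddSector`, crux `OddOneSignedWindows` (item stmt-RiemannHypothesis-17778). The crux asks
for an odd-sector ground state `u` of Weil's windowed form
(`Literature.NumberTheory.LFunctions.IsWeilOddGroundState a u`) with `Im u = 0` and `Re u ≥ 0`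
a.e. on `(0, a)`, on an unbounded set of windows `a`. The companion file
`OddSectorOddOneSignedWindowsExistence.lean` produced odd-sector ground states at every window.
This file disposes of the REALITY clause: Weil's distribution is real, so
`Re Q(g) = Re Q(Re g) + Re Q(Im g)` for every test function
(`re_weilQuadratic_eq_rePart_add_imPart`), and consequently the normalised real part (or, if
that vanishes, the normalised imaginary part) of an odd-sector ground state is again an
odd-sector ground state (`isWeilOddGroundState_rePart`, `isWeilOddGroundState_imPart`,
`exists_real_of_isWeilOddGroundState`). Hence (with `exists_isWeilOddGroundState` of the
companion file) every window `a > 0` carries a REAL-VALUED odd-sector ground state, and the crux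
is reduced to the SIGN of a real odd-sector ground state on `(0, a)`
(`oddOneSignedWindows_of_real_oneSigned`: either sign will do, since `-u` is a ground state with
`u`). This file does not import the companion file (independent elaboration).

The proof of `isWeilOddGroundState_rePart` follows the parity argument of
`isWeilGroundState_evenPart` (Theorems/WeilGroundStateGroundStatesConvergeToXiEvenWitnessParity)
with (even part, odd part) replaced by (real part, imaginary part): along the minimising
sequence `gₙ → u`, `Re Q(gₙ) = Re Q(Re gₙ) + Re Q(Im gₙ)`, `‖gₙ‖² = ‖Re gₙ‖² + ‖Im gₙ‖²`, and
both parts are odd window tests, so `ε_od ‖Re gₙ‖² ≤ Re Q(Re gₙ) ≤ Re Q(gₙ) − ε_od (1 − ‖Re gₙ‖²)`;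
with `Re gₙ → Re u` in `L²` this makes `Re gₙ / ‖Re gₙ‖` a normalised odd minimising sequence
converging to `Re u / ‖Re u‖`.

References: E. Bombieri, Rend. Lincei (9) 11 (2000) §4 (the hermitian form is real on real
functions); H. Yoshida (1992) §2.
-/

noncomputable section

set_option linter.dupNamespace false

open Complex Filter Set MeasureTheory
open scoped Topology ComplexConjugate

namespace Summit.RiemannHypothesis.RiemannHypothesis.Theorems.OddSector

open Literature.NumberTheory.LFunctions

/-! ### Real and imaginary parts: pointwise and `L²` bookkeeping -/

/-- `‖z‖² = ‖Re z‖² + ‖Im z‖²` with both parts coerced back to `ℂ`. [folklore] -/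
theorem norm_sq_eq_norm_rePart_sq_add (z : ℂ) :
    ‖z‖ ^ 2 = ‖((z.re : ℝ) : ℂ)‖ ^ 2 + ‖((z.im : ℝ) : ℂ)‖ ^ 2 := by
  rw [Complex.norm_real, Complex.norm_real, Real.norm_eq_abs, Real.norm_eq_abs, sq_abs, sq_abs,
    Complex.sq_norm, Complex.normSq_apply]
  ring

/-- `‖Re z‖ ≤ ‖z‖` (coerced form). [folklore] -/
theorem norm_rePart_le (z : ℂ) : ‖((z.re : ℝ) : ℂ)‖ ≤ ‖z‖ := by
  rw [Complex.norm_real, Real.norm_eq_abs]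
  exact Complex.abs_re_le_norm z

/-- The real part of a test function is a test function. [folklore] -/
theorem isWeilTest_rePart {g : ℝ → ℂ} (hg : IsWeilTest g) : IsWeilTest fun t ↦ ((g t).re : ℂ) :=
  ⟨Complex.ofRealCLM.contDiff.comp (Complex.reCLM.contDiff.comp hg.1),
    hg.2.comp_left (g := fun z : ℂ ↦ ((z.re : ℝ) : ℂ)) (by simp)⟩

/-- The imaginary part of a test function is a test function. [folklore] -/
theorem isWeilTest_imPart {g : ℝ → ℂ} (hg : IsWeilTest g) : IsWeilTest fun t ↦ ((g t).im : ℂ) :=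
  ⟨Complex.ofRealCLM.contDiff.comp (Complex.imCLM.contDiff.comp hg.1),
    hg.2.comp_left (g := fun z : ℂ ↦ ((z.im : ℝ) : ℂ)) (by simp)⟩

/-- `tsupport (Re g) ⊆ tsupport g`. [folklore] -/
theorem tsupport_rePart_subset (g : ℝ → ℂ) : tsupport (fun t ↦ ((g t).re : ℂ)) ⊆ tsupport g :=
  closure_mono (Function.support_comp_subset (g := fun z : ℂ ↦ ((z.re : ℝ) : ℂ)) (by simp) g)

/-- `tsupport (Im g) ⊆ tsupport g`. [folklore] -/
theorem tsupport_imPart_subset (g : ℝ → ℂ) : tsupport (fun t ↦ ((g t).im : ℂ)) ⊆ tsupport g :=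
  closure_mono (Function.support_comp_subset (g := fun z : ℂ ↦ ((z.im : ℝ) : ℂ)) (by simp) g)

/-- `‖f‖² ∈ L¹` for `f ∈ L²`. [folklore] -/
private theorem integrable_norm_sq_of_memLp' {f : ℝ → ℂ} (hf : MemLp f 2) :
    Integrable fun t ↦ ‖f t‖ ^ 2 :=
  (memLp_two_iff_integrable_sq_norm hf.1).1 hf

/-- The (coerced) real part of an `L²` function is in `L²`. [folklore] -/
theorem memLp_rePart {f : ℝ → ℂ} (hf : MemLp f 2) : MemLp (fun t ↦ (((f t).re : ℝ) : ℂ)) 2 :=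
  MemLp.of_le hf
    ((Complex.continuous_ofReal.comp Complex.continuous_re).comp_aestronglyMeasurable hf.1)
    (Eventually.of_forall fun t ↦ norm_rePart_le (f t))

/-- **Pythagoras for real and imaginary parts in `L²`**: `∫‖Re f‖² + ∫‖Im f‖² = ∫‖f‖²`. [folklore] -/
theorem integral_norm_sq_rePart_add_imPart {f : ℝ → ℂ} (hf : MemLp f 2) :
    (∫ t, ‖(((f t).re : ℝ) : ℂ)‖ ^ 2) + ∫ t, ‖(((f t).im : ℝ) : ℂ)‖ ^ 2 = ∫ t, ‖f t‖ ^ 2 := by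
  have h1 : Integrable fun t ↦ ‖(((f t).re : ℝ) : ℂ)‖ ^ 2 := integrable_norm_sq_of_memLp' (memLp_rePart hf)
  have hfI : MemLp (fun t ↦ -I * f t) 2 := hf.const_mul (-I)
  have h2' : Integrable fun t ↦ ‖((((-I * f t)).re : ℝ) : ℂ)‖ ^ 2 :=
    integrable_norm_sq_of_memLp' (memLp_rePart hfI)
  have h2 : Integrable fun t ↦ ‖(((f t).im : ℝ) : ℂ)‖ ^ 2 := by
    refine h2'.congr (Eventually.of_forall fun t ↦ ?_)
    simp
  rw [← integral_add h1 h2]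
  exact integral_congr_ae (Eventually.of_forall fun t ↦ (norm_sq_eq_norm_rePart_sq_add (f t)).symm)

/-! ### Weil's form is real: `Re Q(g) = Re Q(Re g) + Re Q(Im g)` -/

/-- **Real/imaginary splitting of Weil's quadratic functional.** For every test function `g`,
`Re Q(g) = Re Q(Re g) + Re Q(Im g)`. Proof: with `r = Re g`, `s = Im g` (real-valued test
functions), `g = r + I s` and `ḡ = r − I s`; the expansion of `Re Q` along the real line
through `r` in the direction `I s` (`ConnesVanSuijlekom.re_weilQuadratic_add_real_mul` at `t = ±1`) gives
`Re Q(g) + Re Q(ḡ) = 2 Re Q(r) + 2 Re Q(I s)`, while `Q(ḡ) = Q(g)` (`weilQuadratic_conj`: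
Weil's distribution is real and even) and `Q(I s) = Q(s)` (homogeneity). This is the statement
that Bombieri's hermitian form `T[f * ḡ*]` is REAL on real-valued functions.
[cite: Bombieri2000Weil, §3 (the hermitian form attached to T) and §4] -/
theorem re_weilQuadratic_eq_rePart_add_imPart {g : ℝ → ℂ} (hg : IsWeilTest g) :
    (weilQuadratic g).re =
      (weilQuadratic fun t ↦ ((g t).re : ℂ)).re + (weilQuadratic fun t ↦ ((g t).im : ℂ)).re := by
  have hrt : IsWeilTest fun t ↦ ((g t).re : ℂ) := isWeilTest_rePart hg
  have hst : IsWeilTest fun t ↦ ((g t).im : ℂ) := isWeilTest_imPart hg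
  have hIs : IsWeilTest fun t ↦ I * ((g t).im : ℂ) := hst.const_mul I
  have e1 : ((fun t ↦ ((g t).re : ℂ)) + fun t ↦ ((1 : ℝ) : ℂ) * (I * ((g t).im : ℂ))) = g := by
    funext t
    simp only [Pi.add_apply]
    push_cast
    rw [one_mul, mul_comm]
    exact Complex.re_add_im (g t)
  have e2 : ((fun t ↦ ((g t).re : ℂ)) + fun t ↦ ((-1 : ℝ) : ℂ) * (I * ((g t).im : ℂ))) =
      fun t ↦ conj (g t) := by
    funext t
    simp only [Pi.add_apply]
    apply Complex.ext <;> simp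
  have h1 := ConnesVanSuijlekom.re_weilQuadratic_add_real_mul hrt hIs 1
  have h2 := ConnesVanSuijlekom.re_weilQuadratic_add_real_mul hrt hIs (-1)
  rw [e1] at h1
  rw [e2, weilQuadratic_conj] at h2
  have hI : (weilQuadratic fun t ↦ I * ((g t).im : ℂ)).re = (weilQuadratic fun t ↦ ((g t).im : ℂ)).re := by
    rw [weilQuadratic_const_mul, Complex.normSq_I, Complex.ofReal_one, one_mul]
  rw [hI] at h1 h2
  norm_num at h1 h2
  linarith

/-! ### The normalised real part of an odd-sector ground state is an odd-sector ground state -/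

/-- **The normalised real part of an odd-sector ground state is an odd-sector ground state.**
If `u` is an odd-sector ground state at the window `a` whose real part `Re u` is not `0` in
`L²`, then `Re u/‖Re u‖₂` is an odd-sector ground state at `a`. Proof: for the odd minimising
sequence `gₙ → u` with real/imaginary parts `eₙ, oₙ` (odd window tests),
`Re Q(gₙ) = Re Q(eₙ) + Re Q(oₙ)` and `‖eₙ‖² + ‖oₙ‖² = 1`, so
`ε_od‖eₙ‖² ≤ Re Q(eₙ) ≤ Re Q(gₙ) − ε_od(1 − ‖eₙ‖²)`; `‖eₙ − Re u‖₂ ≤ ‖gₙ − u‖₂ → 0` gives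
`‖eₙ‖² → ‖Re u‖² > 0` and `Re Q(eₙ) → ε_od‖Re u‖²`, whence `eₙ/‖eₙ‖₂` (eventually defined) is
an `L²`-normalised odd minimising sequence converging to `Re u/‖Re u‖₂`.
[cite: Bombieri2000Weil, §4 Problem 2, Thm 3 and §9 Lemma 11] -/
theorem isWeilOddGroundState_rePart {a : ℝ} {u : ℝ → ℂ} (hu : IsWeilOddGroundState a u)
    (hN : 0 < ∫ t, ‖(((u t).re : ℝ) : ℂ)‖ ^ 2) :
    IsWeilOddGroundState a (fun t ↦
      (((Real.sqrt (∫ s, ‖(((u s).re : ℝ) : ℂ)‖ ^ 2))⁻¹ : ℝ) : ℂ) * (((u t).re : ℝ) : ℂ)) := by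
  -- adapted from `isWeilGroundState_evenPart`
  -- (Theorems/WeilGroundStateGroundStatesConvergeToXiEvenWitnessParity.lean), parity ↦ real/imaginary parts
  obtain ⟨hmem, g, hg, hQ, hL⟩ := (isWeilOddGroundState_iff_tendsto a u).1 hu
  set N : ℝ := ∫ s, ‖(((u s).re : ℝ) : ℂ)‖ ^ 2 with hNdef
  set ε : ℝ := weilOddGroundEnergy a with hεdef
  set e : ℕ → ℝ → ℂ := fun n t ↦ (((g n t).re : ℝ) : ℂ) with hedef
  set o : ℕ → ℝ → ℂ := fun n t ↦ (((g n t).im : ℝ) : ℂ) with hodef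
  set ue : ℝ → ℂ := fun t ↦ (((u t).re : ℝ) : ℂ) with huedef
  have hgm : ∀ n, MemLp (g n) 2 := fun n ↦
    (hg n).1.1.continuous.memLp_of_hasCompactSupport (hg n).1.2
  have het : ∀ n, IsWeilTest (e n) := fun n ↦ isWeilTest_rePart (hg n).1
  have hot : ∀ n, IsWeilTest (o n) := fun n ↦ isWeilTest_imPart (hg n).1
  have hes : ∀ n, tsupport (e n) ⊆ Icc (-a) a := fun n ↦
    (tsupport_rePart_subset _).trans (hg n).2.1
  have hos : ∀ n, tsupport (o n) ⊆ Icc (-a) a := fun n ↦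
    (tsupport_imPart_subset _).trans (hg n).2.1
  have heo : ∀ n t, e n (-t) = -e n t := fun n t ↦ by
    simp only [hedef, (hg n).2.2.1 t, Complex.neg_re, Complex.ofReal_neg]
  have hoo : ∀ n t, o n (-t) = -o n t := fun n t ↦ by
    simp only [hodef, (hg n).2.2.1 t, Complex.neg_im, Complex.ofReal_neg]
  have hem : ∀ n, MemLp (e n) 2 := fun n ↦ memLp_rePart (hgm n)
  have huem : MemLp ue 2 := memLp_rePart hmem
  -- norms and energies split along real/imaginary parts
  set Ne : ℕ → ℝ := fun n ↦ ∫ t, ‖e n t‖ ^ 2 with hNedef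
  have hsplit : ∀ n, Ne n + ∫ t, ‖o n t‖ ^ 2 = 1 := fun n ↦ by
    have := integral_norm_sq_rePart_add_imPart (hgm n)
    rw [(hg n).2.2.2] at this
    exact this
  have hQsplit : ∀ n, (weilQuadratic (g n)).re =
      (weilQuadratic (e n)).re + (weilQuadratic (o n)).re := fun n ↦
    re_weilQuadratic_eq_rePart_add_imPart (hg n).1
  have hlow : ∀ n, ε * Ne n ≤ (weilQuadratic (e n)).re := fun n ↦
    weilOddGroundEnergy_mul_le_re (het n) (hes n) (heo n)
  have hupp : ∀ n, (weilQuadratic (e n)).re ≤ (weilQuadratic (g n)).re - ε * (1 - Ne n) := by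
    intro n
    have h1 := weilOddGroundEnergy_mul_le_re (hot n) (hos n) (hoo n)
    have h2 := hsplit n
    have h3 := hQsplit n
    have h4 : ∫ t, ‖o n t‖ ^ 2 = 1 - Ne n := by linarith
    rw [h4] at h1
    linarith
  -- `eₙ → Re u` in `L²`
  have hD : Tendsto (fun n ↦ ∫ t, ‖e n t - ue t‖ ^ 2) atTop (𝓝 0) := by
    refine squeeze_zero (fun n ↦ integral_nonneg fun _ ↦ by positivity) (fun n ↦ ?_) hL
    refine integral_mono (integrable_norm_sq_of_memLp' ((hem n).sub huem))
      (integrable_norm_sq_of_memLp' ((hgm n).sub hmem)) fun t ↦ ?_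
    have e1 : e n t - ue t = (((g n t - u t).re : ℝ) : ℂ) := by
      simp only [hedef, huedef, Complex.sub_re, Complex.ofReal_sub]
    dsimp only
    rw [e1]
    exact pow_le_pow_left₀ (norm_nonneg _) (norm_rePart_le _) 2
  -- `‖eₙ‖² → N`
  have hNe : Tendsto Ne atTop (𝓝 N) := by
    have hsqrt : Tendsto (fun n ↦ Real.sqrt (∫ t, ‖e n t - ue t‖ ^ 2)) atTop (𝓝 0) := by
      simpa using hD.sqrt
    set S : ℝ := Real.sqrt N with hS
    have h1 : ∀ n, Real.sqrt (Ne n) ≤ S + Real.sqrt (∫ t, ‖e n t - ue t‖ ^ 2) := fun n ↦ by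
      have := sqrt_integral_norm_sq_sub_le huem (huem.sub (hem n))
      simpa only [Pi.sub_apply, sub_sub_cancel, norm_sub_rev (ue _)] using this
    have h2 : ∀ n, S ≤ Real.sqrt (Ne n) + Real.sqrt (∫ t, ‖e n t - ue t‖ ^ 2) := fun n ↦ by
      have := sqrt_integral_norm_sq_sub_le (hem n) ((hem n).sub huem)
      simpa only [Pi.sub_apply, sub_sub_cancel] using this
    have h3 : Tendsto (fun n ↦ Real.sqrt (Ne n)) atTop (𝓝 S) := by
      have hup : Tendsto (fun n ↦ S + Real.sqrt (∫ t, ‖e n t - ue t‖ ^ 2)) atTop (𝓝 S) := by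
        simpa using tendsto_const_nhds.add hsqrt
      have hlo : Tendsto (fun n ↦ S - Real.sqrt (∫ t, ‖e n t - ue t‖ ^ 2)) atTop (𝓝 S) := by
        simpa using tendsto_const_nhds.sub hsqrt
      exact tendsto_of_tendsto_of_tendsto_of_le_of_le hlo hup (fun n ↦ by linarith [h2 n])
        (fun n ↦ h1 n)
    have h4 : Tendsto (fun n ↦ Real.sqrt (Ne n) ^ 2) atTop (𝓝 (S ^ 2)) := h3.pow 2
    have h5 : ∀ n, Real.sqrt (Ne n) ^ 2 = Ne n := fun n ↦
      Real.sq_sqrt (integral_nonneg fun _ ↦ by positivity)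
    simp only [h5] at h4
    rwa [hS, Real.sq_sqrt hN.le] at h4
  -- `Re Q(eₙ) → ε N`
  have hQe : Tendsto (fun n ↦ (weilQuadratic (e n)).re) atTop (𝓝 (ε * N)) := by
    have hlo : Tendsto (fun n ↦ ε * Ne n) atTop (𝓝 (ε * N)) := tendsto_const_nhds.mul hNe
    have hup : Tendsto (fun n ↦ (weilQuadratic (g n)).re - ε * (1 - Ne n)) atTop
        (𝓝 (ε * N)) := by
      have h1 : Tendsto (fun n ↦ ε * (1 - Ne n)) atTop (𝓝 (ε * (1 - N))) :=
        tendsto_const_nhds.mul (tendsto_const_nhds.sub hNe)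
      have h2 := hQ.sub h1
      convert h2 using 2
      ring
    exact tendsto_of_tendsto_of_tendsto_of_le_of_le hlo hup hlow hupp
  -- eventually `‖eₙ‖² > N/2`
  obtain ⟨n₀, hn₀⟩ := eventually_atTop.1 (hNe.eventually (lt_mem_nhds (by linarith : N / 2 < N)))
  have hNepos : ∀ n, 0 < Ne (n + n₀) := fun n ↦ by
    have := hn₀ (n + n₀) (Nat.le_add_left _ _)
    linarith
  -- the normalised real parts
  set r : ℕ → ℝ := fun n ↦ (Real.sqrt (Ne (n + n₀)))⁻¹ with hrdef
  set R : ℝ := (Real.sqrt N)⁻¹ with hRdef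
  have hrpos : ∀ n, 0 < r n := fun n ↦ inv_pos.2 (Real.sqrt_pos.2 (hNepos n))
  have hr2 : ∀ n, r n ^ 2 = (Ne (n + n₀))⁻¹ := fun n ↦ by
    rw [hrdef]
    dsimp only
    rw [inv_pow, Real.sq_sqrt (hNepos n).le]
  have hrR : Tendsto r atTop (𝓝 R) :=
    ((hNe.comp (tendsto_add_atTop_nat n₀)).sqrt.inv₀ (Real.sqrt_ne_zero'.2 hN))
  refine IsWeilOddGroundState.of_tendsto (huem.const_mul _)
    (g := fun n t ↦ ((r n : ℝ) : ℂ) * e (n + n₀) t) (fun n ↦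
    ⟨(het _).const_mul _, tsupport_mul_subset_right.trans (hes _), fun t ↦ ?_, ?_⟩) ?_ ?_
  · -- oddness
    rw [heo, mul_neg]
  · -- normalisation
    simp only [norm_mul, mul_pow, Complex.norm_real, Real.norm_of_nonneg (hrpos n).le]
    rw [integral_const_mul, hr2 n]
    exact inv_mul_cancel₀ (hNepos n).ne'
  · -- energies
    have key : ∀ n, (weilQuadratic (fun t ↦ ((r n : ℝ) : ℂ) * e (n + n₀) t)).re =
        (Ne (n + n₀))⁻¹ * (weilQuadratic (e (n + n₀))).re := fun n ↦ by
      rw [weilQuadratic_const_mul, Complex.normSq_ofReal, Complex.re_ofReal_mul, ← sq, hr2 n]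
    have h1 : Tendsto (fun n ↦ (Ne (n + n₀))⁻¹ * (weilQuadratic (e (n + n₀))).re) atTop
        (𝓝 (N⁻¹ * (ε * N))) :=
      ((hNe.comp (tendsto_add_atTop_nat n₀)).inv₀ hN.ne').mul
        (hQe.comp (tendsto_add_atTop_nat n₀))
    have h2 : N⁻¹ * (ε * N) = ε := by field_simp
    rw [h2] at h1
    exact h1.congr fun n ↦ (key n).symm
  · -- `L²` convergence to `R · Re u`
    have hD' : Tendsto (fun n ↦ ∫ t, ‖e (n + n₀) t - ue t‖ ^ 2) atTop (𝓝 0) :=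
      hD.comp (tendsto_add_atTop_nat n₀)
    have hNe' : Tendsto (fun n ↦ Ne (n + n₀)) atTop (𝓝 N) := hNe.comp (tendsto_add_atTop_nat n₀)
    have hpt : ∀ n t, ‖((r n : ℝ) : ℂ) * e (n + n₀) t - (R : ℂ) * ue t‖ ^ 2 ≤
        2 * (r n - R) ^ 2 * ‖e (n + n₀) t‖ ^ 2 + 2 * R ^ 2 * ‖e (n + n₀) t - ue t‖ ^ 2 := by
      intro n t
      have e1 : ((r n : ℝ) : ℂ) * e (n + n₀) t - (R : ℂ) * ue t =
          ((r n - R : ℝ) : ℂ) * e (n + n₀) t + (R : ℂ) * (e (n + n₀) t - ue t) := by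
        push_cast
        ring
      rw [e1]
      have h1 := norm_add_le (((r n - R : ℝ) : ℂ) * e (n + n₀) t) ((R : ℂ) * (e (n + n₀) t - ue t))
      rw [norm_mul, norm_mul, Complex.norm_real (r n - R), Complex.norm_real R,
        Real.norm_eq_abs (r n - R), Real.norm_eq_abs R] at h1
      have h2 : 0 ≤ |r n - R| * ‖e (n + n₀) t‖ := by positivity
      have h3 : 0 ≤ |R| * ‖e (n + n₀) t - ue t‖ := by positivity
      calc ‖((r n - R : ℝ) : ℂ) * e (n + n₀) t + (R : ℂ) * (e (n + n₀) t - ue t)‖ ^ 2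
          ≤ (|r n - R| * ‖e (n + n₀) t‖ + |R| * ‖e (n + n₀) t - ue t‖) ^ 2 :=
            pow_le_pow_left₀ (norm_nonneg _) h1 2
        _ ≤ 2 * (|r n - R| * ‖e (n + n₀) t‖) ^ 2 + 2 * (|R| * ‖e (n + n₀) t - ue t‖) ^ 2 := by
            nlinarith [sq_nonneg (|r n - R| * ‖e (n + n₀) t‖ - |R| * ‖e (n + n₀) t - ue t‖)]
        _ = 2 * (r n - R) ^ 2 * ‖e (n + n₀) t‖ ^ 2 + 2 * R ^ 2 * ‖e (n + n₀) t - ue t‖ ^ 2 := by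
            rw [mul_pow, mul_pow, sq_abs, sq_abs]; ring
    have hbound : ∀ n, ∫ t, ‖((r n : ℝ) : ℂ) * e (n + n₀) t - (R : ℂ) * ue t‖ ^ 2 ≤
        2 * (r n - R) ^ 2 * Ne (n + n₀) + 2 * R ^ 2 * ∫ t, ‖e (n + n₀) t - ue t‖ ^ 2 := by
      intro n
      have hi1 : Integrable fun t ↦ ‖e (n + n₀) t‖ ^ 2 := integrable_norm_sq_of_memLp' (hem _)
      have hi2 : Integrable fun t ↦ ‖e (n + n₀) t - ue t‖ ^ 2 :=
        integrable_norm_sq_of_memLp' ((hem _).sub huem)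
      have hi3 : Integrable fun t ↦
          2 * (r n - R) ^ 2 * ‖e (n + n₀) t‖ ^ 2 + 2 * R ^ 2 * ‖e (n + n₀) t - ue t‖ ^ 2 :=
        (hi1.const_mul (2 * (r n - R) ^ 2)).add (hi2.const_mul (2 * R ^ 2))
      have := integral_mono_of_nonneg (Eventually.of_forall fun t ↦ by positivity) hi3
        (Eventually.of_forall (hpt n))
      rw [integral_add (hi1.const_mul _) (hi2.const_mul _), integral_const_mul,
        integral_const_mul] at this
      exact this
    have hlim0 : Tendsto (fun n ↦ 2 * (r n - R) ^ 2 * Ne (n + n₀) +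
        2 * R ^ 2 * ∫ t, ‖e (n + n₀) t - ue t‖ ^ 2) atTop (𝓝 0) := by
      have h1 : Tendsto (fun n ↦ r n - R) atTop (𝓝 0) := by
        simpa using hrR.sub_const R
      have h2 : Tendsto (fun n ↦ 2 * (r n - R) ^ 2 * Ne (n + n₀)) atTop (𝓝 (2 * 0 ^ 2 * N)) :=
        (tendsto_const_nhds.mul (h1.pow 2)).mul hNe'
      have h3 : Tendsto (fun n ↦ 2 * R ^ 2 * ∫ t, ‖e (n + n₀) t - ue t‖ ^ 2) atTop
          (𝓝 (2 * R ^ 2 * 0)) :=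
        tendsto_const_nhds.mul hD'
      simpa using h2.add h3
    exact squeeze_zero (fun n ↦ integral_nonneg fun _ ↦ by positivity) hbound hlim0

/-- **The normalised imaginary part of an odd-sector ground state is an odd-sector ground
state** (apply `isWeilOddGroundState_rePart` to the ground state `-I·u`, whose real part is
`Im u`). [folklore] -/
theorem isWeilOddGroundState_imPart {a : ℝ} {u : ℝ → ℂ} (hu : IsWeilOddGroundState a u)
    (hN : 0 < ∫ t, ‖(((u t).im : ℝ) : ℂ)‖ ^ 2) :
    IsWeilOddGroundState a (fun t ↦
      (((Real.sqrt (∫ s, ‖(((u s).im : ℝ) : ℂ)‖ ^ 2))⁻¹ : ℝ) : ℂ) * (((u t).im : ℝ) : ℂ)) := by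
  have hu' : IsWeilOddGroundState a (fun t ↦ -I * u t) := hu.const_mul (by simp)
  have hre : ∀ t, ((-I * u t).re : ℂ) = ((u t).im : ℂ) := fun t ↦ by simp
  have h := isWeilOddGroundState_rePart hu' (by simpa only [hre] using hN)
  simpa only [hre] using h

/-- **Every odd-sector ground state yields a REAL-VALUED one at the same window**: its
normalised real part, or (if `Re u = 0` in `L²`) its normalised imaginary part
(`∫‖Re u‖² + ∫‖Im u‖² = ∫‖u‖² = 1`). [folklore] -/
theorem exists_real_of_isWeilOddGroundState {a : ℝ} {u : ℝ → ℂ} (hu : IsWeilOddGroundState a u) :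
    ∃ v : ℝ → ℂ, IsWeilOddGroundState a v ∧ ∀ t, (v t).im = 0 := by
  have hsum := integral_norm_sq_rePart_add_imPart hu.memLp
  rw [hu.integral_norm_sq] at hsum
  have h1 : 0 ≤ ∫ t, ‖(((u t).re : ℝ) : ℂ)‖ ^ 2 := integral_nonneg fun _ ↦ by positivity
  rcases h1.eq_or_lt with hz | hpos
  · have hpos' : 0 < ∫ t, ‖(((u t).im : ℝ) : ℂ)‖ ^ 2 := by linarith
    exact ⟨_, isWeilOddGroundState_imPart hu hpos', fun t ↦ by simp [Complex.mul_im]⟩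
  · exact ⟨_, isWeilOddGroundState_rePart hu hpos, fun t ↦ by simp [Complex.mul_im]⟩

/-- **Reduction of the crux to a sign statement about REAL odd-sector ground states.** If
beyond every height there is a window `a` carrying a real-valued odd-sector ground state which
is ONE-SIGNED a.e. on `(0, a)` — either `≥ 0` or `≤ 0` there — then `OddOneSignedWindows` holds
(in the second case pass to the ground state `-v`, `IsWeilOddGroundState.neg`). [folklore] -/
theorem oddOneSignedWindows_of_real_oneSigned
    (h : ∀ A : ℝ, ∃ a : ℝ, A ≤ a ∧ ∃ v : ℝ → ℂ, IsWeilOddGroundState a v ∧ (∀ t, (v t).im = 0) ∧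
      ((∀ᵐ t : ℝ, t ∈ Ioo 0 a → 0 ≤ (v t).re) ∨ (∀ᵐ t : ℝ, t ∈ Ioo 0 a → (v t).re ≤ 0))) :
    Summit.RiemannHypothesis.RiemannHypothesis.Theses.OddSector.OddOneSignedWindows := by
  -- the route statement is, definitionally, `∀ A, ∃ a ≥ A, ∃ u, IsWeilOddGroundState a u ∧ (sign clause)`
  show ∀ A : ℝ, ∃ a : ℝ, A ≤ a ∧ ∃ u : ℝ → ℂ, IsWeilOddGroundState a u ∧
    (∀ᵐ t : ℝ, t ∈ Ioo 0 a → (u t).im = 0 ∧ 0 ≤ (u t).re)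
  intro A
  obtain ⟨a, hAa, v, hv, hreal, hsign | hsign⟩ := h A
  · exact ⟨a, hAa, v, hv, hsign.mono fun t ht hta ↦ ⟨hreal t, ht hta⟩⟩
  · refine ⟨a, hAa, fun t ↦ -v t, hv.neg, hsign.mono fun t ht hta ↦ ⟨?_, ?_⟩⟩
    · simp [hreal t]
    · have := ht hta
      simp only [Complex.neg_re]
      linarith

end Summit.RiemannHypothesis.RiemannHypothesis.Theorems.OddSector

end
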